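import Literature.AlgebraicGeometry.Frobenioids.GeometricDivisorDataSupportWitness
import Literature.AlgebraicGeometry.Frobenioids.GeometricDivisorPrimes
import HarnessLib

/-!
# Frobenioids I, Theorem 6.2 (iii): the FACT-LIST row `Thm62iii` SETTLED — `_holds` at THE Frobenioid of
# geometric origin for every `GeometricDivisorData`, and the universal closure of the schema REFUTED

Mochizuki, *The geometry of Frobenioids I: the general theory*, Kyushu J. Math. **62** (2008) 293–400, Thm. 6.2
(iii), kurims p. 111: "`C` [the Frobenioid of Ex. 6.1] is of isotropic, standard and birationally Frobenius-normalized
type, but not of group-like type.  If, moreover, for every finite extension `L ⊆ K̃` of `K`, and every `D ∈ D_L`,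
it holds that `D` lies in the support of the image in `Φ(L)^gp` of an element of `B(L)`, then `C` is of rationally
standard type" [cite: MochizukiFrdI2008, Thm. 6.2 (iii) p.111]; proof p. 112 [cite: MochizukiFrdI2008, Thm. 6.2 (iii) p.112];
Def. 4.5 (ii)–(iii) p. 86 (rational / rationally standard type, over a support predicate `Supp`)
[cite: MochizukiFrdI2008, Def. 4.5 (iii) p.86]; Ex. 6.1 p. 109 ("`D_K` is `K̃`-`ℚ`-Cartier", `Prime(Φ(L)) ≃ D_L`)
[cite: MochizukiFrdI2008, Ex. 6.1 p.109].

PROOF-ONLY companion of `GeometricFrobenioids.lean` (cell abc-iut, seat abc-iut-f-001, F fact-proving wave,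
FROZEN FACT-LIST row **F-1104** `Thm62iii`; no definition, no statement re-typed, the declaring file is imported,
never edited).  Seat abc-iut-L1-t3 typed Thm. 6.2 (iii) as the SCHEMA
`Thm62iii (M : GeometricModelFrobenioid Γ C) (Bi : M.ops.BiratData) (R : M.ops.RSParams)` over DATA-ONLY
parameters (the model `M`, a birationalization datum `Bi`, the Def. 4.5 (iii) parameters `R`).  This file records
the kernel facts that settle the row under plan rule R5 ("a universal closure of a schema row is not a fact — prove
the instance forms the consumers cite"):

* `thm62iii_holds` — the schema HOLDS at THE instances the cone consumes: THE Frobenioid of geometric origin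
  `C_{K̃/K}` (`geomModelFrobenioid Γ`, seat abc-iut-L6-t10), THE birationalization (`PreFrobenioid.biratData`) and THE
  parameters of Def. 4.5 (iii) (`PreFrobenioid.rsParams … PrimarySupp`), for EVERY field `K`, Galois `K̃/K` and EVERY
  instance `Γ` of the interface `GeometricDivisorData K K̃` — by seat abc-iut-L6-t10's `Thm62iii_rsParams`
  (`GeometricFrobenioidFrobeniusCompact.lean`) BY NAME; fully-qualified type.
* `not_thm62iii_rsParams_top` — already at THE model and THE birationalization the schema is FALSE for a junk
  support predicate (`Supp := ⊤`) whenever the printed zero-or-pole hypothesis holds: then "rationally standard"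
  would follow, but no object is rational in the sense of Def. 4.5 (ii) (every `Φ(L)` over a nonempty `D_L` has a
  prime — the class of a Cartier multiple of a prime divisor, `qCartier` + `isPrimary_of_support_eq_singleton`; and
  `D_L ≠ ∅` propagates along `V[L] → V[M]` by `over_surjective` from the standing hypothesis `D_K ≠ ∅`).
* `not_thm62iii_univ` — hence the universal closure of the schema (over `K, K̃, Γ, C, M, Bi, R`, at the universe
  levels of THE model) is FALSE, witnessed at seat abc-iut-w4-d092's `GeometricDivisorData.exists_support_witness`
  (`K = K̃ = ℚ`, hypothesis TRUE): the row is consumable AT THE NAMED INSTANCES ONLY (`thm62iii_holds`).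

Nothing here bears on [IUTchIII] Cor. 3.12 or asserts anything about abc; no side taken.
-/

noncomputable section

namespace Literature.AlgebraicGeometry.Frobenioids

open CategoryTheory

section F1104

variable {K : Type} [Field K] {Kt : Type} [Field Kt] [Algebra K Kt]

/-- `Φ(L)` has a prime over every prime divisor `P ∈ D_L` (Ex. 6.1 p. 109, "`Prime(Φ(L)) ≃ D_L`"): the class of
a Cartier multiple `n · P ∈ Φ(L)` (`qCartier`), primary because supported at the single prime divisor `P`.
[cite: MochizukiFrdI2008, Ex. 6.1 p.109] -/
theorem GeometricDivisorData.nonempty_primes_phi (Γ : GeometricDivisorData K Kt) (X : FinSubextCat K Kt)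
    (P : Γ.primeDiv X) : Nonempty (Primes (Multiplicative (Γ.Phi X))) := by
  obtain ⟨n, hn, hmem⟩ := Γ.qCartier X P
  exact ⟨Quotient.mk (primarySetoid _) ⟨Multiplicative.ofAdd (⟨Finsupp.single P n, hmem⟩ : Γ.Phi X),
    Γ.isPrimary_of_support_eq_singleton X (Finsupp.support_single P hn.ne')⟩⟩

variable [IsGalois K Kt] (Γ : GeometricDivisorData K Kt)

/-- **FACT-LIST row F-1104 `Thm62iii` HOLDS at THE instances** ([FrdI] Thm. 6.2 (iii), kurims p. 111: "`C` is of
isotropic, standard and birationally Frobenius-normalized type, but not of group-like type [and, under the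
zero-or-pole hypothesis,] of rationally standard type"): seat abc-iut-L1-t3's schema at THE Frobenioid of geometric
origin `C_{K̃/K}` of Ex. 6.1 (`geomModelFrobenioid Γ`), THE birationalization of Prop. 4.4
(`PreFrobenioid.biratData`) and THE parameters of Def. 4.5 (iii) (`PreFrobenioid.rsParams`, support = Def. 2.4 (i)(d)
`PrimarySupp`), for every field `K`, Galois `K̃/K` and every `Γ : GeometricDivisorData K K̃` — seat abc-iut-L6-t10's
`Thm62iii_rsParams` BY NAME (fully-qualified type; R5: instance form, the universal closure being false,
`not_thm62iii_univ`). [cite: MochizukiFrdI2008, Thm. 6.2 (iii) p.111] -/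
theorem thm62iii_holds :
    Literature.AlgebraicGeometry.Frobenioids.Thm62iii (geomModelFrobenioid Γ)
      (PreFrobenioid.biratData (geomFrobenioid_isFrobenioid Γ)
        (PreFrobenioid.hasBiratSquares_of_isFrobenioid (geomFrobenioid_isFrobenioid Γ)))
      (PreFrobenioid.rsParams (geomFrobenioid_isFrobenioid Γ) fun a 𝔭 => PrimarySupp a 𝔭) :=
  Thm62iii_rsParams Γ

/-- **R5 evidence, at THE model**: under the printed zero-or-pole hypothesis, the schema
`Thm62iii (geomModelFrobenioid Γ) (THE C^birat) R` is FALSE for the Def. 4.5 (iii) parameters with the JUNK support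
predicate `Supp := ⊤`: its last clause would make `C` rationally standard for `⊤`, but no object `A` is then
rational (Def. 4.5 (ii) asks, for each prime `𝔭` of `Φ(Base A')`, for `b ∈ Φ` with `𝔭 ∉ Supp(b)`; and `Φ(Base A')`
has a prime, `D_{Base A'} ≠ ∅` lying over `D_L ≠ ∅`).  The schema is faithful to print only at THE support of
Def. 2.4 (i)(d) (`thm62iii_holds`). [cite: MochizukiFrdI2008, Def. 4.5 (iii) p.86] -/
theorem not_thm62iii_rsParams_top
    (hsupport : ∀ (X : FinSubextCat K Kt) (P : Γ.primeDiv X), ∃ f : Γ.B X, (Multiplicative.toAdd (Γ.div X f)) P ≠ 0) :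
    ¬ Literature.AlgebraicGeometry.Frobenioids.Thm62iii (geomModelFrobenioid Γ)
        (PreFrobenioid.biratData (geomFrobenioid_isFrobenioid Γ)
          (PreFrobenioid.hasBiratSquares_of_isFrobenioid (geomFrobenioid_isFrobenioid Γ)))
        (PreFrobenioid.rsParams (geomFrobenioid_isFrobenioid Γ) fun _ _ => True) := by
  intro h
  obtain ⟨X₀, ⟨P₀⟩⟩ := Γ.primeDiv_nonempty
  obtain ⟨A', φ, -, hsr⟩ := (h.2.2.2.2 hsupport).rational ⟨X₀, 1⟩
  obtain ⟨Q, -⟩ := Γ.over_surjective ((geomFrobenioidOps Γ).base.map φ) P₀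
  obtain ⟨𝔭⟩ := GeometricDivisorData.nonempty_primes_phi Γ ((geomFrobenioidOps Γ).base.obj A') Q
  obtain ⟨_, _, -, -, hnot⟩ := hsr 𝔭
  exact hnot True.intro

end F1104

/-- **The universal closure of the schema `Thm62iii` is FALSE** (plan rule R5: FACT-LIST row F-1104 is consumable
AT THE NAMED INSTANCES ONLY, `thm62iii_holds`): quantified over all fields `K`, Galois `K̃/K`, interface data
`Γ`, categories `C`, data `M : GeometricModelFrobenioid Γ C`, birationalization data `Bi` and parameters `R` (at the
universe levels of THE model), it fails at seat abc-iut-w4-d092's witness `Γ : GeometricDivisorData ℚ ℚ` (zero-or-pole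
hypothesis TRUE, `GeometricDivisorData.exists_support_witness`), THE model, THE birationalization and the junk
support `⊤` (`not_thm62iii_rsParams_top`). [cite: MochizukiFrdI2008, Thm. 6.2 (iii) p.111] -/
theorem not_thm62iii_univ :
    ¬ ∀ (K : Type) [Field K] (Kt : Type) [Field Kt] [Algebra K Kt] [IsGalois K Kt] (Γ : GeometricDivisorData K Kt)
        (C : Type) [Category.{0} C] (M : GeometricModelFrobenioid Γ C)
        (Bi : PreFrobenioidData.BiratData.{0, 0, 0, 0, 0, 0} M.ops)
        (R : PreFrobenioidData.RSParams.{0, 0, 0, 0, 0, 0} M.ops),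
        Literature.AlgebraicGeometry.Frobenioids.Thm62iii M Bi R := by
  intro h
  obtain ⟨Γ, hΓ⟩ := GeometricDivisorData.exists_support_witness
  exact not_thm62iii_rsParams_top Γ hΓ (h ℚ ℚ Γ (geomFrobenioid Γ) (geomModelFrobenioid Γ) _ _)

end Literature.AlgebraicGeometry.Frobenioids

end
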